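import Summits.CriticalPhenomena.CardyFormulaZ2.Theorems.CardyUniqueLimitCardyRigidityLoewnerKit
import Literature.Probability.RandomPlanarGeometry.LoewnerBoundaryExtension
import HarnessLib

/-!
# Loewner–Carathéodory convergence kit, VII: equicontinuity up to the boundary upgrades interior convergence

Crux `Summit.CriticalPhenomena.CardyFormulaZ2.Theses.CardyUniqueLimit.CardyRigidity`
(stmt-CriticalPhenomena-0746), line `crossing_martingale`, helper kit for the registered stub A3b
`stub_slitObservableApprox`.  Pommerenke's Corollary 2.4 ("if furthermore `f_n(z) → f(z)` for each
`z` then the convergence is uniform in the closed disc") has two halves: EQUICONTINUITY up to the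
boundary (his Prop. 2.3, from uniform local connectedness of the complements — in this line the
output of the conformal kit / the exploration-regularity good set at the tip) and the elementary
upgrade of interior convergence by equicontinuity.  This file proves the upgrade (L4 modulo
equicontinuity) in the half-plane model:

* `tendstoUniformlyOn_of_equicontinuous` — for maps `F_n, f : ℂ → ℂ` along any filter: if the `F_n`
  are eventually uniformly equicontinuous on `{im ≥ 0} ∩ D̄(0, X+1)`, `f` is uniformly continuous
  there, and `F_n → f` uniformly on `{im ≥ y} ∩ D̄(0, X+1)` for every `y ∈ (0, 1]`, then `F_n → f`
  uniformly on `{im ≥ 0} ∩ D̄(0, X)` (push each point up by `iy`);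
* `tendstoUniformlyOn_bdryInv_of_equicontinuous` — for the boundary extensions
  `f̄^{w}_t = Loewner.bdryInv w t` of the inverse Loewner maps along `(t, w) → (t₀, w₀)` in
  `ℝ≥0 × C([0,∞), ℝ)`: eventual uniform equicontinuity of the `f̄^{w}_t` on
  `{im ≥ 0} ∩ D̄(0, X+1)` and continuity of `f̄^{w₀}_{t₀}` on `{im ≥ 0}` (e.g. a chain generated by a
  curve, `Loewner.IsGeneratedByCurve.continuousOn_bdryInv`) give `f̄^{w}_t → f̄^{w₀}_{t₀}` uniformly
  on `{im ≥ 0} ∩ D̄(0, X)` — the interior convergence being kit I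
  (`tendstoUniformlyOn_loewnerInv_nhds`, `f̄ = f` on `ℍ`).

References: Pommerenke (1992) §2.2 Prop. 2.3, Cor. 2.4; Lawler–Schramm–Werner (2004) Lemma 3.14.
-/

noncomputable section

open Set Filter Topology Metric
open scoped NNReal
open UpperHalfPlane (upperHalfPlaneSet)
open Literature.Probability.RandomPlanarGeometry Literature.Probability.RandomPlanarGeometry.Loewner

namespace Summit.CriticalPhenomena.CardyFormulaZ2.Cruxes.CardyRigidity.CrossingMartingale

namespace LoewnerKit

/-- **Equicontinuity up to the boundary upgrades interior convergence to convergence on the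
closed half-plane** (the elementary half of Pommerenke's Cor. 2.4, half-plane model).  Along a
filter `l`, let `F_n, f : ℂ → ℂ` with: the `F_n` eventually uniformly equicontinuous on
`S⁺ = {im ≥ 0} ∩ D̄(0, X+1)`; `f` uniformly continuous on `S⁺`; and `F_n → f` uniformly on
`{im ≥ y} ∩ D̄(0, X+1)` for every `y ∈ (0, 1]`.  Then `F_n → f` uniformly on `{im ≥ 0} ∩ D̄(0, X)`.
[cite: PommerenkeBBCM1992, Cor. 2.4] -/
theorem tendstoUniformlyOn_of_equicontinuous {ι : Type*} {l : Filter ι} {F : ι → ℂ → ℂ}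
    {f : ℂ → ℂ} {X : ℝ}
    (hequi : ∀ ε : ℝ, 0 < ε → ∃ δ : ℝ, 0 < δ ∧ ∀ᶠ n in l,
      ∀ v ∈ {z : ℂ | 0 ≤ z.im} ∩ closedBall (0 : ℂ) (X + 1),
      ∀ v' ∈ {z : ℂ | 0 ≤ z.im} ∩ closedBall (0 : ℂ) (X + 1), dist v v' < δ → dist (F n v) (F n v') < ε)
    (hf : UniformContinuousOn f ({z : ℂ | 0 ≤ z.im} ∩ closedBall (0 : ℂ) (X + 1)))
    (hconv : ∀ y : ℝ, 0 < y → y ≤ 1 →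
      TendstoUniformlyOn F f l ({z : ℂ | y ≤ z.im} ∩ closedBall (0 : ℂ) (X + 1))) :
    TendstoUniformlyOn F f l ({z : ℂ | 0 ≤ z.im} ∩ closedBall (0 : ℂ) X) := by
  rw [Metric.tendstoUniformlyOn_iff]
  intro ε hε
  have hε3 : 0 < ε / 3 := by positivity
  obtain ⟨δ₁, hδ₁, hequi'⟩ := hequi (ε / 3) hε3
  obtain ⟨δ₂, hδ₂, hf'⟩ := Metric.uniformContinuousOn_iff.1 hf (ε / 3) hε3
  set y : ℝ := min (min δ₁ δ₂ / 2) 1 with hy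
  have hypos : 0 < y := lt_min (by positivity) one_pos
  have hy1 : y ≤ 1 := min_le_right _ _
  have hyδ₁ : y < δ₁ := by
    have : y ≤ min δ₁ δ₂ / 2 := min_le_left _ _
    have : min δ₁ δ₂ ≤ δ₁ := min_le_left _ _
    linarith
  have hyδ₂ : y < δ₂ := by
    have : y ≤ min δ₁ δ₂ / 2 := min_le_left _ _
    have : min δ₁ δ₂ ≤ δ₂ := min_le_right _ _
    linarith
  filter_upwards [hequi', (Metric.tendstoUniformlyOn_iff.1 (hconv y hypos hy1)) _ hε3] with n hn hn'
  rintro v ⟨hv0, hvX⟩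
  have hv0' : 0 ≤ v.im := hv0
  -- the pushed-up point `v' = v + iy`
  set v' : ℂ := v + (y : ℂ) * Complex.I with hv'
  have hvv' : dist v v' = y := by
    rw [dist_comm, Complex.dist_eq, hv', add_sub_cancel_left, norm_mul, Complex.norm_real,
      Complex.norm_I, mul_one, Real.norm_of_nonneg hypos.le]
  have hv'im : v'.im = v.im + y := by simp [hv']
  have hvS : v ∈ {z : ℂ | 0 ≤ z.im} ∩ closedBall (0 : ℂ) (X + 1) :=
    ⟨hv0, closedBall_subset_closedBall (by linarith) hvX⟩
  have hv'X : v' ∈ closedBall (0 : ℂ) (X + 1) := by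
    rw [mem_closedBall] at hvX ⊢
    calc dist v' 0 ≤ dist v' v + dist v 0 := dist_triangle _ _ _
      _ ≤ y + X := by rw [dist_comm, hvv']; linarith
      _ ≤ X + 1 := by linarith
  have hv'S : v' ∈ {z : ℂ | 0 ≤ z.im} ∩ closedBall (0 : ℂ) (X + 1) :=
    ⟨show 0 ≤ v'.im by rw [hv'im]; linarith, hv'X⟩
  have hv'y : v' ∈ {z : ℂ | y ≤ z.im} ∩ closedBall (0 : ℂ) (X + 1) :=
    ⟨show y ≤ v'.im by rw [hv'im]; linarith, hv'X⟩
  have h1 : dist (F n v) (F n v') < ε / 3 := hn v hvS v' hv'S (by rw [hvv']; exact hyδ₁)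
  have h2 : dist (f v') (F n v') < ε / 3 := hn' v' hv'y
  have h3 : dist (f v) (f v') < ε / 3 := hf' v hvS v' hv'S (by rw [hvv']; exact hyδ₂)
  calc dist (f v) (F n v) ≤ dist (f v) (f v') + dist (f v') (F n v') + dist (F n v') (F n v) :=
        dist_triangle4 _ _ _ _
    _ < ε / 3 + ε / 3 + ε / 3 := by
        gcongr
        rwa [dist_comm]
    _ = ε := by ring

/-- **(L4 modulo equicontinuity) Convergence of the boundary extensions of the inverse Loewner
maps on compacts of the closed half-plane.**  Along `(t, w) → (t₀, w₀)` in `ℝ≥0 × C([0,∞), ℝ)`: if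
the boundary extensions `f̄^{w}_t = Loewner.bdryInv w t` are eventually uniformly equicontinuous on
`{im ≥ 0} ∩ D̄(0, X+1)` (the output of uniform local connectedness of the complements, Pommerenke
Prop. 2.3) and `f̄^{w₀}_{t₀}` is continuous on `{im ≥ 0}` (e.g. the chain of `w₀` is generated by a
curve, `Loewner.IsGeneratedByCurve.continuousOn_bdryInv`), then `f̄^{w}_t → f̄^{w₀}_{t₀}` uniformly
on `{im ≥ 0} ∩ D̄(0, X)`; the interior convergence is kit I. [cite: PommerenkeBBCM1992, Cor. 2.4]
[cite: LawlerSchrammWerner2004, Lemma 3.14] -/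
theorem tendstoUniformlyOn_bdryInv_of_equicontinuous (q₀ : ℝ≥0 × C(ℝ≥0, ℝ)) {X : ℝ}
    (hequi : ∀ ε : ℝ, 0 < ε → ∃ δ : ℝ, 0 < δ ∧ ∀ᶠ q : ℝ≥0 × C(ℝ≥0, ℝ) in 𝓝 q₀,
      ∀ v ∈ {z : ℂ | 0 ≤ z.im} ∩ closedBall (0 : ℂ) (X + 1),
      ∀ v' ∈ {z : ℂ | 0 ≤ z.im} ∩ closedBall (0 : ℂ) (X + 1), dist v v' < δ →
        dist (bdryInv q.2 q.1 v) (bdryInv q.2 q.1 v') < ε)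
    (hcont : ContinuousOn (bdryInv q₀.2 q₀.1) {z : ℂ | 0 ≤ z.im}) :
    TendstoUniformlyOn (fun (q : ℝ≥0 × C(ℝ≥0, ℝ)) (v : ℂ) ↦ bdryInv q.2 q.1 v)
      (bdryInv q₀.2 q₀.1) (𝓝 q₀) ({z : ℂ | 0 ≤ z.im} ∩ closedBall (0 : ℂ) X) := by
  refine tendstoUniformlyOn_of_equicontinuous hequi ?_ ?_
  · have hK : IsCompact ({z : ℂ | 0 ≤ z.im} ∩ closedBall (0 : ℂ) (X + 1)) :=
      (isCompact_closedBall _ _).inter_left (isClosed_le continuous_const Complex.continuous_im)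
    exact hK.uniformContinuousOn_of_continuous (hcont.mono inter_subset_left)
  · intro y hy _
    have h := (tendstoUniformlyOn_loewnerInv_nhds q₀ hy).mono
      (show {z : ℂ | y ≤ z.im} ∩ closedBall (0 : ℂ) (X + 1) ⊆ {z : ℂ | y ≤ z.im} from
        inter_subset_left)
    refine h.congr ?_ |>.congr_right ?_
    · filter_upwards with q
      intro v hv
      exact (bdryInv_eq_of_mem q.2.continuous q.1 (show 0 < v.im from hy.trans_le hv.1)).symm
    · intro v hv
      exact (bdryInv_eq_of_mem q₀.2.continuous q₀.1 (show 0 < v.im from hy.trans_le hv.1)).symm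

end LoewnerKit

/-- **Registered form** (anchor `loewnerKit_tendstoUniformlyOn_bdryInv_of_equicontinuous` of stmt-CriticalPhenomena-0746):
eventual uniform equicontinuity of the boundary extensions `f̄^{w}_t` on `{im ≥ 0} ∩ D̄(0, X+1)` near `(t₀, w₀)` and
continuity of `f̄^{w₀}_{t₀}` on the closed half-plane give `f̄^{w}_t → f̄^{w₀}_{t₀}` uniformly on `{im ≥ 0} ∩ D̄(0, X)`
(L4 modulo equicontinuity; Pommerenke Cor. 2.4). [cite: PommerenkeBBCM1992, Cor. 2.4] -/
theorem loewnerKit_tendstoUniformlyOn_bdryInv_of_equicontinuous : ∀ (q₀ : NNReal × ContinuousMap NNReal ℝ) {X : ℝ}, (∀ ε : ℝ, 0 < ε → ∃ δ : ℝ, 0 < δ ∧ ∀ᶠ q : NNReal × ContinuousMap NNReal ℝ in nhds q₀, ∀ v ∈ {z : ℂ | 0 ≤ z.im} ∩ Metric.closedBall (0 : ℂ) (X + 1), ∀ v' ∈ {z : ℂ | 0 ≤ z.im} ∩ Metric.closedBall (0 : ℂ) (X + 1), dist v v' < δ → dist (Literature.Probability.RandomPlanarGeometry.Loewner.bdryInv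 (⇑q.2) q.1 v) (Literature.Probability.RandomPlanarGeometry.Loewner.bdryInv (⇑q.2) q.1 v') < ε) → ContinuousOn (Literature.Probability.RandomPlanarGeometry.Loewner.bdryInv (⇑q₀.2) q₀.1) {z : ℂ | 0 ≤ z.im} → TendstoUniformlyOn (fun (q : NNReal × ContinuousMap NNReal ℝ) (v : ℂ) ↦ Literature.Probability.RandomPlanarGeometry.Loewner.bdryInv (⇑q.2) q.1 v) (Literature.Probability.RandomPlanarGeometry.Loewner.bdryInv (⇑q₀.2) q₀.1) (nhds q₀) ({z : ℂ | 0 ≤ z.im} ∩ Metric.closedBall (0 : ℂ) X) :=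
  fun q₀ _ hequi hcont ↦ LoewnerKit.tendstoUniformlyOn_bdryInv_of_equicontinuous q₀ hequi hcont

end Summit.CriticalPhenomena.CardyFormulaZ2.Cruxes.CardyRigidity.CrossingMartingale

end
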